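import Literature.AnabelianGeometry.AbsoluteAnabelian.AbsTopIII.KummerFaithfulDedekindInductionStepProofs
import Literature.AnabelianGeometry.AbsoluteAnabelian.AbsTopIII.KummerFaithfulTrdegInductionProofs
import Literature.AnabelianGeometry.AbsoluteAnabelian.AbsTopIII.KummerFaithfulPadicAbelianProofs
import Literature.AnabelianGeometry.AbsoluteAnabelian.AbsTopIII.KummerFaithfulBaseChangeProofs
import HarnessLib

/-!
# [AbsTopIII] Rmk. 1.5.4 (i) PROVED: every sub-`p`-adic field is Kummer-faithful (FACT-LIST row F-0369)

Proof-only companion (no new definitions) to `AbsTopIII/KummerFaithful.lean` (S. Mochizuki, *Topics in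
Absolute Anabelian Geometry III*, §1, Def. 1.5 p. 32 and Rmk. 1.5.4 (i) p. 33, lit key
`paper:url-5493eb38cbb7`): "every sub-`p`-adic field `k` [...] is Kummer-faithful, i.e. 'sub-`p`-adic
⟹ Kummer-faithful'. Indeed, to verify this, one reduces immediately, by base-change, to the case
where `k` is a finitely generated extension of an MLF [...]. Then by restricting to various closed
points of this variety, one reduces to the case where `k` itself is an MLF [...] if `k` [...] is a finite
extension of `ℚ_p`, then `A(k_H)` is an extension of a finitely generated `ℤ`-module by a compact
abelian `p`-adic Lie group [...]. In particular, the condition of Definition 1.5, (a), is satisfied."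

This file CLOSES the named fact `Rmk_1_5_4_i` of `KummerFaithful.lean` (cell abc-iut, FACT-LIST row
F-0369) with the tree's typing of `IsKummerFaithful` (tori and abelian varieties; implied by the
printed definition): **`Rmk_1_5_4_i_holds : Rmk_1_5_4_i`**.  It is the 30-line assembly of the route
of record (memo F0369-FG-ROUTE, abc-iut-f-083) whose junctions were landed by five seats:

* REDUCTION to finitely generated extensions of `ℚ_p` ("by base-change"):
  `Rmk_1_5_4_i_of_abelianVariety_clause_fg` (`KummerFaithfulBaseChangeProofs`, abc-iut-f-083) — the
  torus clause `IsSubpadic.isTorallyKummerFaithful` being proved there;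
* the MLF case of Def. 1.5 (a) for abelian varieties ("compact abelian `p`-adic Lie group" — here:
  `A(K)` is profinite in the strong topology): `AbelianVariety.divisibleElementsTrivial_points_of_finite_padic`
  (`KummerFaithfulPadicAbelianProofs`, abc-iut-f-085);
* "restricting to various closed points of this variety", ONE TRANSCENDENCE DEGREE AT A TIME:
  `divisibleElementsTrivial_points_of_finite_ratFunc_of_residueFields`
  (`KummerFaithfulDedekindInductionStepProofs`, abc-iut-f-080: Dedekind model of a finite extension of
  `F(X)` — abc-iut-f-083 J-a; spreading out to a proper smooth group scheme over `R[1/f]` = its Néron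
  model — tree `exists_abelianScheme_away_holds`, `isNeronModel_of_isProper_of_smooth`; divisible
  points ↦ divisible sections — abc-iut-f-083/f-070 J-c; the special fibres at the closed points are
  ABELIAN VARIETIES by Zariski's connectedness theorem over a Dedekind base — abc-iut-f-080 J-b/J-b′,
  `ZariskiConnectednessDVR`, `AbelianSchemeSpecialFibreDedekind`; sections agreeing at infinitely
  many closed points are equal — abc-iut-f-083/f-078 J-d);
* the field-theoretic induction on the number of generators ("this variety" has transcendence degree
  `d`; peel off one variable): `fg_curve_induction` (`KummerFaithfulTrdegInductionProofs`,
  abc-iut-f-072).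

HONEST SCOPE.  `IsKummerFaithful` is the tree's typing (condition (a) of Def. 1.5 for TORI and ABELIAN
VARIETIES over finite extensions; the printed definition quantifies over all semi-abelian varieties and
implies it).  Nothing here bears on [IUTchIII] Cor. 3.12; a FACT-LIST row is an assumption label of
the cell's conditional verification, now discharged as a theorem of the tree (Mathlib axioms only).
-/

noncomputable section

namespace Literature.AnabelianGeometry.AbsoluteAnabelian.AbsTopIII

universe u

open Polynomial Literature.AlgebraicGeometry.Motives

/-- **Condition (a) of Def. 1.5 for every abelian variety over every finitely generated extension of
`ℚ_p`** (the hypothesis `hAV` of `Rmk_1_5_4_i_of_abelianVariety_clause_fg`): `⋂_{N ≥ 1} N · A(L) = {0}`.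
Induction on the number of generators (`essFiniteType_curve_induction`, run over the copy
`⊥ ⊆ L` of `ℚ_p` in the universe of `L`, the principle being mono-universe): the base case (finite
over `ℚ_p`) is the profinite-points argument `AbelianVariety.divisibleElementsTrivial_points_of_finite_padic`; the step
("restricting to various closed points of this variety", [AbsTopIII] Rmk. 1.5.4 (i) p. 33) is
`divisibleElementsTrivial_points_of_finite_ratFunc_of_residueFields`.
[cite: MochizukiAbsTopIII2015, Rmk 1.5.4 (i) p.33] -/
theorem divisibleElementsTrivial_points_of_fg_padic (p : ℕ) [Fact p.Prime] (L : Type u) [Field L]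
    [Algebra ℚ_[p] L] (hL : (⊤ : IntermediateField ℚ_[p] L).FG) (A : AbelianVariety L) :
    DivisibleElementsTrivial (A.Points L) := by
  -- the base field: the copy `K₀ = ⊥ ⊆ L` of `ℚ_p` in the universe of `L` (the induction principle
  -- is mono-universe; an intermediate field avoids the `ULift` instance diamonds)
  let K₀ : IntermediateField ℚ_[p] L := ⊥
  haveI : CharZero K₀ := charZero_of_injective_algebraMap (algebraMap ℚ_[p] K₀).injective
  haveI : Algebra.EssFiniteType ℚ_[p] L := IntermediateField.fg_top_iff.mp hL
  haveI : Algebra.EssFiniteType K₀ L := Algebra.EssFiniteType.of_comp ℚ_[p] K₀ L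
  refine essFiniteType_curve_induction (K₀ := K₀)
    (fun E _ _ => ∀ B : AbelianVariety E, DivisibleElementsTrivial (B.Points E)) ?_ ?_ L A
  · -- finite extensions of `ℚ_p`: `A(K)` is profinite, hence has no divisible elements
    intro E _ _ _ B
    letI : Algebra ℚ_[p] E := ((algebraMap K₀ E).comp (algebraMap ℚ_[p] K₀)).toAlgebra
    haveI : IsScalarTower ℚ_[p] K₀ E := IsScalarTower.of_algebraMap_eq fun _ => rfl
    haveI : Module.Finite ℚ_[p] K₀ :=
      Module.Finite.equiv (IntermediateField.botEquiv ℚ_[p] L).symm.toLinearEquiv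
    haveI : FiniteDimensional ℚ_[p] E := Module.Finite.trans K₀ E
    exact AbelianVariety.divisibleElementsTrivial_points_of_finite_padic p B E
  · -- one transcendence degree: restrict to the closed points of a curve over `L₀`
    intro L₀ _ _ _ ih L' _ _ _ _ _ _ _ _ _ _ _ B
    haveI : CharZero L₀ := charZero_of_injective_algebraMap (algebraMap K₀ L₀).injective
    refine divisibleElementsTrivial_points_of_finite_ratFunc_of_residueFields L₀ L'
      (fun κ _ _ hfin B' => ?_) B
    letI : Algebra K₀ κ := ((algebraMap L₀ κ).comp (algebraMap K₀ L₀)).toAlgebra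
    haveI : IsScalarTower K₀ L₀ κ := IsScalarTower.of_algebraMap_eq fun _ => rfl
    haveI : FiniteDimensional L₀ κ := hfin
    exact ih κ B'

/-- **[AbsTopIII] Rmk. 1.5.4 (i): every sub-`p`-adic field is Kummer-faithful** ("sub-`p`-adic ⟹
Kummer-faithful", p. 33) — FACT-LIST row F-0369 `Rmk_1_5_4_i` PROVED, for the tree's typing of
`IsKummerFaithful` (tori: `IsSubpadic.isTorallyKummerFaithful`; abelian varieties:
`divisibleElementsTrivial_points_of_fg_padic` through `Rmk_1_5_4_i_of_abelianVariety_clause_fg`).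
[cite: MochizukiAbsTopIII2015, Rmk 1.5.4 (i) p.33] -/
theorem Rmk_1_5_4_i_holds : Literature.AnabelianGeometry.AbsoluteAnabelian.AbsTopIII.Rmk_1_5_4_i.{u} :=
  Rmk_1_5_4_i_of_abelianVariety_clause_fg fun p _ L _ _ hL A =>
    divisibleElementsTrivial_points_of_fg_padic p L hL A

/-- **Sub-`p`-adic fields are Kummer-faithful**, instance form of `Rmk_1_5_4_i_holds`.
[cite: MochizukiAbsTopIII2015, Rmk 1.5.4 (i) p.33] -/
theorem IsSubpadic.isKummerFaithful {k : Type u} [Field k] (hk : IsSubpadic k) :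
    IsKummerFaithful k :=
  Rmk_1_5_4_i_holds k hk

/-- **Every finitely generated extension of `ℚ_p` is Kummer-faithful** (it is sub-`p`-adic, witnessed
by itself). [cite: MochizukiAbsTopIII2015, Rmk 1.5.4 (i) p.33] -/
theorem isKummerFaithful_of_fg_padic (p : ℕ) [Fact p.Prime] (L : Type) [Field L] [Algebra ℚ_[p] L]
    (hL : (⊤ : IntermediateField ℚ_[p] L).FG) : IsKummerFaithful L :=
  Rmk_1_5_4_i_holds L ⟨⟨p, inferInstance, ⟨⟨L, inferInstance, inferInstance, hL, ⟨RingHom.id L⟩⟩⟩⟩⟩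

end Literature.AnabelianGeometry.AbsoluteAnabelian.AbsTopIII

end
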